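import Mathlib
import Literature.NumberTheory.Transcendental.LinEDSCells
import Summits.KontsevichZagierPeriods.KontsevichZagierPeriods.Theorems.FurushoPentagonKernelModuloPeriodConjectureLeafOfCheckBlocksC
import HarnessLib


/-!
# `KernelModuloPeriodConjecture`, line `Sketch`: the leaf from cell blocks with precomputed filler rows

Crux `FurushoPentagon.KernelModuloPeriodConjecture` (stmt-KontsevichZagierPeriods-15058), line
`Sketch`, lead c7. Corollary of the cell block master `stub_leaf_of_checkBlocksC` for certificates
whose blocks carry PRECOMPUTED filler rows (`LinEDS.checkBlockCX`, engine §15): if the extras of a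
block have provenance (`LinEDS.checkExtra`: each is the spread of the masked row of a group of valid
names free of the later cells — decided in separate files and glued by `checkExtra_append`), then
the plain check `checkBlockC` holds for the block with the groups CONCATENATED pairwise
(`checkBlockC_of_checkBlockCX`): the kernel-computed rows of the concatenated groups, masked to the
block, are literally the rows the extra-check eliminated. Hence the weight-`k` leaf
(`stub_leaf_of_checkBlocksCX`). Nothing new is trusted: the determinant/parity argument is the one
of `stub_leaf_of_checkBlocksC`.

References: K. Ihara, M. Kaneko, D. Zagier, Compos. Math. 142 (2006) §2, Conjecture 1
[IharaKanekoZagier2006]; F. Brown, Ann. of Math. 175 (2012) Thm 1.1 [Brown2012].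
-/

namespace Summit.KontsevichZagierPeriods.FurushoPentagon.KernelModuloPeriodConjecture

open Literature.NumberTheory.Transcendental
open Literature.NumberTheory.Transcendental.LinEDS

/-! ### Small facts about the §15 vocabulary -/

/-- `xorAll` over an appended list. [folklore] -/
theorem blocksCX_xorAll_append : ∀ l l' : List ℕ, LinEDS.xorAll (l ++ l') = LinEDS.xorAll l ^^^ LinEDS.xorAll l'
  | [], l' => by simp [LinEDS.xorAll]
  | a :: l, l' => by rw [List.cons_append, LinEDS.xorAll, LinEDS.xorAll, blocksCX_xorAll_append l l', Nat.xor_assoc]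

/-- The row of a concatenated group is the XOR of the rows. [folklore] -/
theorem blocksCX_rowBitsG_append (k : ℕ) (g g' : List (List ℕ × List ℕ)) :
    LinEDS.rowBitsG k (g ++ g') = LinEDS.rowBitsG k g ^^^ LinEDS.rowBitsG k g' := by
  rw [LinEDS.rowBitsG, LinEDS.rowBitsG, LinEDS.rowBitsG, List.map_append, blocksCX_xorAll_append]

/-- Spreading the empty bitset adds nothing. [folklore] -/
theorem blocksCX_spread_zero : ∀ (L : List ℕ) (acc : ℕ), LinEDS.spread L 0 acc = acc
  | [], acc => rfl
  | c :: cs, acc => by rw [LinEDS.spread]; exact blocksCX_spread_zero cs acc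

/-- `(x ^^^ y) &&& m = (x &&& m) ^^^ (y &&& m)`. [folklore] -/
theorem blocksCX_and_xor_distrib (x y m : ℕ) : (x ^^^ y) &&& m = (x &&& m) ^^^ (y &&& m) :=
  Nat.and_xor_distrib_right

/-- Unpacking `checkExtraAux` along the lists: lengths, validity, no later bits, and the masked rows
of the concatenated groups are the rows of `rowsX`. [folklore] -/
theorem blocksCX_extraAux {k mask higher : ℕ} {L : List ℕ} :
    ∀ (groups : List (List (List ℕ × List ℕ))) (es : List ℕ) (pgs : List (List (List ℕ × List ℕ))),
      LinEDS.checkExtraAux k mask higher L es pgs = true → groups.length = es.length →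
        pgs.length = es.length ∧
        (∀ g ∈ pgs, (∀ μ ∈ g, LinEDS.validName k μ = true) ∧ LinEDS.rowBitsG k g &&& higher = 0) ∧
        ((List.zipWith (· ++ ·) groups pgs).map fun g => LinEDS.rowBitsG k g &&& mask) =
          (LinEDS.rowsX k L groups es).map (· &&& mask)
  | groups, [], [], _, hl => by
    cases groups with
    | nil => simp [LinEDS.rowsX]
    | cons g gs => simp at hl
  | groups, [], pg :: pgs, h, _ => by simp [LinEDS.checkExtraAux] at h
  | groups, e :: es, [], h, _ => by simp [LinEDS.checkExtraAux] at h
  | [], e :: es, pg :: pgs, _, hl => by simp at hl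
  | g :: gs, e :: es, pg :: pgs, h, hl => by
    simp only [LinEDS.checkExtraAux, Bool.and_eq_true, List.all_eq_true, beq_iff_eq] at h
    obtain ⟨⟨⟨hval, hno⟩, heq⟩, hrest⟩ := h
    have heq' : LinEDS.spread L e 0 = LinEDS.rowBitsG k pg &&& mask := Nat.eq_of_beq_eq_true heq
    obtain ⟨hlen, hall, hrows⟩ := blocksCX_extraAux gs es pgs hrest (by simpa using hl)
    refine ⟨by simp [hlen], ?_, ?_⟩
    · intro g' hg'
      rcases List.mem_cons.mp hg' with rfl | hg'
      · exact ⟨hval, hno⟩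
      · exact hall g' hg'
    · rw [List.zipWith_cons_cons, List.map_cons, LinEDS.rowsX, List.map_cons, hrows]
      congr 1
      rw [blocksCX_rowBitsG_append, blocksCX_and_xor_distrib, ← heq']
      cases he : (e == 0)
      · simp only [cond_false]
        rw [blocksCX_and_xor_distrib, heq', Nat.land_assoc, Nat.and_self]
      · have he0 : e = 0 := by simpa using he
        subst he0
        simp only [cond_true]
        rw [blocksCX_spread_zero, Nat.xor_zero]

/-- `sameLength` says the lengths agree (re-export of the E13 fact under a local name). [folklore] -/
theorem blocksCX_sameLength {α β : Type*} {l : List α} {l' : List β}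
    (h : LinEDS.sameLength l l' = true) : l.length = l'.length :=
  (sameLength_eq_true_iff _ _).mp h

/-! ### `checkBlockCX ∧ checkExtra ⇒ checkBlockC` -/

/-- **Extras with provenance reduce to the plain cell block check**: for the groups concatenated
pairwise with the provenance groups, `checkBlockC` holds — its kernel-computed rows, masked to the
block, are the rows eliminated by `checkBlockCX`. [cite: IharaKanekoZagier2006, Conjecture 1] -/
theorem checkBlockC_of_checkBlockCX {k W' f : ℕ} {cells later : List (ℕ × List ℕ)} {L : List ℕ}
    {groups pgroups : List (List (List ℕ × List ℕ))} {extra : List ℕ}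
    (hX : LinEDS.checkBlockCX k W' f cells later L groups extra = true)
    (hE : LinEDS.checkExtra k cells later L extra pgroups = true) :
    LinEDS.checkBlockC k W' f cells later L (List.zipWith (· ++ ·) groups pgroups) = true := by
  simp only [LinEDS.checkBlockCX, Bool.and_eq_true, List.all_eq_true, List.mem_map,
    forall_exists_index, and_imp, forall_apply_eq_imp_iff₂, beq_iff_eq, Nat.blt_eq,
    LinEDS.lengthTR_eq] at hX
  obtain ⟨⟨⟨⟨⟨⟨⟨hlen, hsame⟩, hmask⟩, hinc⟩, hlt⟩, hval⟩, hno⟩, helim⟩ := hX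
  have hlen' : groups.length = L.length := Nat.eq_of_beq_eq_true hlen
  have hge : groups.length = extra.length := blocksCX_sameLength hsame
  obtain ⟨hplen, hpall, hrows⟩ := blocksCX_extraAux groups extra pgroups hE hge
  simp only [LinEDS.checkBlockC, Bool.and_eq_true, List.all_eq_true, List.mem_map,
    forall_exists_index, and_imp, forall_apply_eq_imp_iff₂, beq_iff_eq, Nat.blt_eq,
    LinEDS.lengthTR_eq]
  refine ⟨⟨⟨⟨⟨⟨?_, hmask⟩, hinc⟩, hlt⟩, ?_⟩, ?_⟩, ?_⟩
  · -- as many concatenated groups as columns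
    have : (List.zipWith (· ++ ·) groups pgroups).length = L.length := by
      rw [List.length_zipWith, hplen, ← hge, min_self]; exact hlen'
    rw [this]; exact Nat.beq_refl _
  · -- validity of every member of a concatenated group
    intro g hg μ hμ
    obtain ⟨i, hi, rfl⟩ := List.getElem_of_mem hg
    rw [List.getElem_zipWith] at hμ
    rcases List.mem_append.mp hμ with hμ | hμ
    · exact hval _ (List.getElem_mem _) μ hμ
    · exact (hpall _ (List.getElem_mem _)).1 μ hμ
  · -- no bit in the later cells
    intro g hg
    obtain ⟨i, hi, rfl⟩ := List.getElem_of_mem hg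
    rw [List.getElem_zipWith, blocksCX_rowBitsG_append, blocksCX_and_xor_distrib,
      hno _ (List.getElem_mem _), (hpall _ (List.getElem_mem _)).2, Nat.xor_zero]
  · -- the eliminated matrix is the same
    set M := LinEDS.cellsMask k cells &&& LinEDS.colMask k with hM
    have hmat : ((List.zipWith (· ++ ·) groups pgroups).map (LinEDS.rowBitsG k)).map
        (fun r => LinEDS.xorFold W' f (r &&& M)) =
        (LinEDS.rowsX k L groups extra).map (fun r => LinEDS.xorFold W' f (r &&& M)) := by
      rw [List.map_map]
      have hcomp : ((fun r => LinEDS.xorFold W' f (r &&& M)) ∘ LinEDS.rowBitsG k) =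
          (LinEDS.xorFold W' f) ∘ (fun g => LinEDS.rowBitsG k g &&& M) := rfl
      rw [hcomp, ← List.map_map, hrows, List.map_map]
      rfl
    rw [hmat]
    exact helim

/-! ### The registered stub -/

/-- **The leaf from a chain of cell block certificates, plain or with precomputed filler rows**
(registered stub `stub_leaf_of_checkBlocksCX`, lead c7; crux stmt-KontsevichZagierPeriods-15058,
line `Sketch`): a chain `bl` of blocks `(cells, later)` with `chainOK k bl`, each block certified
EITHER by the plain `checkBlockC` OR by `checkBlockCX` together with the provenance `checkExtra` of
its extras (at some width with enough fuel) ⇒ the weight-`k` slice of the algebraic leaf.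
[cite: IharaKanekoZagier2006, Conjecture 1] -/
theorem stub_leaf_of_checkBlocksCX :
    ∀ (k : ℕ) (bl : List (List (ℕ × List ℕ) × List (ℕ × List ℕ))), 2 ≤ k →
      LinEDS.chainOK k bl = true →
      (∀ p ∈ bl,
        (∃ (W' f : ℕ) (L : List ℕ) (groups : List (List (List ℕ × List ℕ))),
          2 ^ (k - 1) ≤ W' * (f + 1) ∧ LinEDS.checkBlockC k W' f p.1 p.2 L groups = true) ∨
        (∃ (W' f : ℕ) (L : List ℕ) (groups : List (List (List ℕ × List ℕ))) (extra : List ℕ)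
            (pgroups : List (List (List ℕ × List ℕ))),
          2 ^ (k - 1) ≤ W' * (f + 1) ∧ LinEDS.checkBlockCX k W' f p.1 p.2 L groups extra = true ∧
            LinEDS.checkExtra k p.1 p.2 L extra pgroups = true)) →
      ∀ s : List ℕ, MZV.IsAdmissible s → MZV.weight s = k →
        ∃ b : List ℕ →₀ ℚ, (∀ t ∈ b.support, MZV.IsHoffman t ∧ MZV.weight t = MZV.weight s) ∧ ∀ (R : Type) [CommRing R] [Algebra ℚ R] [IsReduced R] (φ : NCSeries Bool R), NCSeries.IsGroupLike φ → NCSeries.DrinfeldPentagon φ → φ (MZV.binaryWord s) = b.sum (fun t q => q • φ (MZV.binaryWord t)) := by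
  intro k bl hk hchain hblocks s hs hw
  refine stub_leaf_of_checkBlocksC k bl hk hchain (fun p hp => ?_) s hs hw
  rcases hblocks p hp with h | ⟨W', f, L, groups, extra, pgroups, hfuel, hX, hE⟩
  · exact h
  · exact ⟨W', f, L, _, hfuel, checkBlockC_of_checkBlockCX hX hE⟩

end Summit.KontsevichZagierPeriods.FurushoPentagon.KernelModuloPeriodConjecture
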